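import Summits.BirchSwinnertonDyer.BirchSwinnertonDyer.Theorems.ResidualThetaTransportAtTwoThetaLayerLambdaCongruenceAtTwoCuspSpanGenerationB1
import Literature.NumberTheory.ModularForms.EisensteinCovectorGamma0Prime
import HarnessLib

/-!
# Route `ResidualThetaTransportAtTwo`, cruxes Kan⁺ `ThetaLayerLambdaCongruenceAtTwo` (stmt-BirchSwinnertonDyer-20688) / Kμ⁺ /
# 21437: the FOUR-SHIFT form (♠)_N of the curve-free node — «a class of `H¹(X₀(N); 𝔽₂)` killing the loops `{0 → b/4^k}` is
# invariant under the partial conjugation by `diag(4, 1)`» — sandwiched (G′)_N ⟹ (♠)_N ⟹ (G″)_N, hence sufficient for FLAT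

Cell `bsd-wall`, width seat `bsd-wall-rtt-p3-w3` g6 (helper; THEOREMS ONLY — no `def`, no named fact, no `sorry`; (G′)_N, (♠)_N,
(G″)_N are HYPOTHESES spelled inline / by the name `SignedMuAtTwo.CuspSpanEvenAtTwo`; `--supports stmt-BirchSwinnertonDyer-20688`;
BSD is not proved by this).

THE NODE. The only research content left in Kan⁺ (line `birth` v12) and in Kμ⁺ is the per-level, curve-free statement
(G′)_N = `CuspSpanEvenAtTwo N` (`…CuspSpanDefs`), or its weaker `T₂`-kernel form (G″)_N (`…CuspSpanHeckeKernel`: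
`V^even_N + T₂ H₁(X₀(N); 𝔽₂) = H₁`), each sufficient for FLAT (`flatAtTwo_of_cuspSpan`, `flatAtTwo_of_heckeKernelSpan`).

THIS FILE inserts a third per-level statement between them. For an additive `χ : Γ₀(N) → ZMod 2` through the period homology
write `Φ(a, c) := χ(γ)` for any `γ ∈ Γ₀(N)` of first column `(a, c)ᵀ` (well defined, §1: two such `γ` differ by `±T^m` on the
right). The hypothesis V «`χ` kills every `γ` with `|d(γ)| = 4^k`, `k ≥ 1`» is the vanishing of `χ` on the loops `{0 → b/4^k}`;
the FOUR-SHIFT conclusion is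

  (Inv4)  `Φ(a, 4c) = Φ(a, c)` for every primitive `(a, c)` with `N ∣ c`, `a` odd — i.e. `χ(a, 4b; c, d) = χ(a, b; 4c, d)` for
          every `(a, b; 4c, d) ∈ Γ₀(4N)`: invariance of `χ` under `γ ↦ diag(4,1)⁻¹ γ diag(4,1)` where defined,

and (♠)_N is «V ⟹ (Inv4)» for every such `χ`. Results:

* §1 `chi_eq_of_col_eq` — `χ` depends only on the first column.
* §2 `chi_eq_zero_of_fourShift_of_heckeT_two` — **(Inv4) ∧ (`χ` is `T₂`-killed) ⟹ `χ = 0`**, in five lines of first-column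
  calculus with the explicit Hecke correspondents `colB`, `colD` of `Literature.…EisensteinCovector` (`{∞,γ∞}_{T₂h} = Σ {∞,δ∞}_h`):
  for `4 ∣ c` (`c = 2c₂`) the `T₂`-relation at the element of first column `(a − c₂, c₂)` reads
  `Φ(a − c₂, 2c₂) + Φ(a, 2c₂) + Φ(a − c₂, c₂/2) = 0` and (Inv4) equates the two outer terms, so `Φ` vanishes at every `(a, c)`
  with `4 ∣ c`; (Inv4) again and `T`-translation give `Φ ≡ 0`. No Hecke–Shimura lemma, no amalgam, no congruence-subgroup
  property is needed in this direction.
* §3 `fourShift_of_cuspSpan` — (G′)_N ⟹ (♠)_N (one line: `ψ(d) = ψ(d')` since `d ≡ d' ≡ a⁻¹ (mod N)`);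
  `heckeKernelSpan_of_fourShift` — (♠)_N ⟹ (G″)_N (odd `N`); hence `flatAtTwo_of_fourShift`, `flatMuZeroAtTwo_of_fourShift`,
  `signedMuAnalyticAtTwoPlus_of_abbesUllmo_of_fourShift` (item 21437 by name, granted Abbes–Ullmo).

WHY (♠)_N (memo `Cruxes/ThetaLayerLambdaCongruenceAtTwo/Lines/birth-fourshift.md`): (Inv4) is EXACTLY the condition for `χ` to
extend to an additive character of the `2`-arithmetic group `Λ(N) = Γ₀(N)[1/2] = Γ₀(N) *_{Γ₀(2N)} Γ₀(N)^{diag(2,1)}` (Ihara–Serre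
amalgam acting on the Bruhat–Tits tree of `SL₂(ℚ₂)`); every additive `𝔽₂`-character of `Λ(N)` kills the unipotents
`U⁺(ℤ[1/2]) ∪ U⁻(Nℤ[1/2])`, hence the `4^k`-classes `U⁺(b/4^k) diag(4^{-k},4^k) U⁻(c/4^k)` (so (Inv4) ⟹ V for free), and by the
congruence subgroup property of `SL₂(ℤ[1/2])` (Mennicke 1967, Serre 1970) `Hom(Λ(N), 𝔽₂) = Hom((ℤ/N)ˣ, 𝔽₂) ∘ d̄` — which is
Ribet's form of Ihara's lemma at `p = 2` with `𝔽₂`-coefficients; so (♠)_N ⟹ (G′)_N as well and the three nodes are equivalent in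
truth value (verified numerically: `{χ : (Inv4)} = {ψ ∘ d̄}` for every odd `N ≤ 119`). Homologically (G′)_N reads
`Im(π₂* − T₂ π₁* : H₁(X₀(2N); 𝔽₂) → H₁(X₀(N); 𝔽₂)) ⊆ V^even_N`, i.e. `[{x, 4x}] ∈ V^even_N` for every `x = b/d`, `d` odd prime to
`N` — a GENERATION statement at level `4N` («for a generating set of `Γ₀(4N)`, `[γ] + [diag(4,1) γ diag(4,1)⁻¹] ∈ V^even_N`»)
complementary to the lead's (T_N). Not used below; BSD is not proved by any of this.

References: J.-P. Serre, *Trees* (1980) II.1.4 (the amalgam `SL₂(ℤ[1/p])`); J. Mennicke, *On Ihara's modular group*, Invent.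
Math. 4 (1967); J.-P. Serre, *Le problème des groupes de congruence pour SL₂*, Ann. of Math. 92 (1970); K. Ribet, *Congruence
relations between modular forms*, Proc. ICM 1983, Thm. 4.1 [Ribet1984]; J. E. Cremona, *Algorithms for modular elliptic curves*
(1997) §2.4 [CremonaAlgorithms1997]; R. Pollack, Duke Math. J. 118 (2003) Conj. 6.3 [Pollack2003].
-/

set_option autoImplicit false
-- justification: the `Summit.BirchSwinnertonDyer.BirchSwinnertonDyer.…` path repeats a component (route-file convention)
set_option linter.dupNamespace false

noncomputable section

open scoped Classical MatrixGroups ModularForm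

open CongruenceSubgroup WeierstrassCurve Literature.NumberTheory.EllipticCurves
  Literature.NumberTheory.EllipticCurves.ModularForms Literature.NumberTheory.EllipticCurves.Rank1Residual
  Literature.NumberTheory.IwasawaTheory Summit.BirchSwinnertonDyer.Rank1Residual.Supersingular
  Summit.BirchSwinnertonDyer.BirchSwinnertonDyer.Theses.ResidualThetaTransportAtTwo
  Literature.NumberTheory.ModularForms.EisensteinCovector

namespace Summit.BirchSwinnertonDyer.BirchSwinnertonDyer.Theorems.SignedMuAtTwo

/-! ## §1. An additive character killing the small traces depends only on the first column -/

section FirstColumn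

variable {N : ℕ} {χ : Gamma0 N → ZMod 2}

/-- **`χ` is a function of the first column.** For additive `χ : Γ₀(N) → ZMod 2` killing the elements of trace `0, ±1, ±2` and
`γ, γ' ∈ Γ₀(N)` with the same first column `(a, c)ᵀ`: `χ γ = χ γ'` — indeed `γ' = γ (1 m; 0 1)` with
`m = d b' − b d'`. (So `χ γ` is a function `Φ(a, c)` of the cusp `γ∞ = a/c` together with its sign class.) [folklore] -/
theorem chi_eq_of_col_eq (hadd : ∀ γ δ : Gamma0 N, χ (γ * δ) = χ γ + χ δ)
    (hsmall : ∀ γ : Gamma0 N, ((γ : SL(2, ℤ)) 0 0 + (γ : SL(2, ℤ)) 1 1).natAbs ≤ 2 → χ γ = 0)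
    {γ γ' : Gamma0 N} (h00 : (γ : SL(2, ℤ)) 0 0 = (γ' : SL(2, ℤ)) 0 0)
    (h10 : (γ : SL(2, ℤ)) 1 0 = (γ' : SL(2, ℤ)) 1 0) : χ γ = χ γ' := by
  have hdet := Matrix.SpecialLinearGroup.det_coe (γ : SL(2, ℤ))
  have hdet' := Matrix.SpecialLinearGroup.det_coe (γ' : SL(2, ℤ))
  rw [Matrix.det_fin_two] at hdet hdet'
  -- the unipotent `u = (1 m; 0 1)`, `m = d b' − b d'`
  obtain ⟨u, hu00, hu01, hu10, hu11⟩ :=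
    ThetaLayerLambdaCongruenceAtTwo.exists_gamma0_entries (N := N) 1
      ((γ : SL(2, ℤ)) 1 1 * (γ' : SL(2, ℤ)) 0 1 - (γ : SL(2, ℤ)) 0 1 * (γ' : SL(2, ℤ)) 1 1) 0 1 (by ring) (dvd_zero _)
  have hu : χ u = 0 := hsmall u (by rw [hu00, hu11]; rfl)
  have hprod : γ * u = γ' := by
    refine ThetaLayerLambdaCongruenceAtTwo.gamma0_ext ?_ ?_ ?_ ?_
    · rw [gamma0_mul_apply_zero_zero', hu00, hu10, mul_one, mul_zero, add_zero, h00]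
    · rw [gamma0_mul_apply_zero_one, hu01, hu11, mul_one]
      linear_combination (γ' : SL(2, ℤ)) 0 1 * hdet - (γ : SL(2, ℤ)) 0 1 * hdet' -
        (γ : SL(2, ℤ)) 0 1 * (γ' : SL(2, ℤ)) 1 1 * h00 + (γ : SL(2, ℤ)) 0 1 * (γ' : SL(2, ℤ)) 0 1 * h10
    · rw [ThetaLayerLambdaCongruenceAtTwo.gamma0_mul_apply_one_zero, hu00, hu10, mul_one, mul_zero, add_zero, h10]
    · rw [gamma0_mul_apply_one_one', hu01, hu11, mul_one]
      linear_combination (γ' : SL(2, ℤ)) 1 1 * hdet - (γ : SL(2, ℤ)) 1 1 * hdet' -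
        (γ : SL(2, ℤ)) 1 1 * (γ' : SL(2, ℤ)) 1 1 * h00 + (γ : SL(2, ℤ)) 1 1 * (γ' : SL(2, ℤ)) 0 1 * h10
  rw [← hprod, hadd, hu, add_zero]

/-- The translation `T = (1 1; 0 1)`: `χ(Tγ) = χ γ`, and `Tγ` has first column `(a + c, c)`. [folklore] -/
theorem exists_chi_eq_col_add (hadd : ∀ γ δ : Gamma0 N, χ (γ * δ) = χ γ + χ δ)
    (hsmall : ∀ γ : Gamma0 N, ((γ : SL(2, ℤ)) 0 0 + (γ : SL(2, ℤ)) 1 1).natAbs ≤ 2 → χ γ = 0) (γ : Gamma0 N) :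
    ∃ γ' : Gamma0 N, (γ' : SL(2, ℤ)) 0 0 = (γ : SL(2, ℤ)) 0 0 + (γ : SL(2, ℤ)) 1 0 ∧
      (γ' : SL(2, ℤ)) 1 0 = (γ : SL(2, ℤ)) 1 0 ∧ χ γ' = χ γ := by
  obtain ⟨T, hT00, hT01, hT10, hT11⟩ :=
    ThetaLayerLambdaCongruenceAtTwo.exists_gamma0_entries (N := N) 1 1 0 1 (by ring) (dvd_zero _)
  refine ⟨T * γ, ?_, ?_, ?_⟩
  · rw [gamma0_mul_apply_zero_zero', hT00, hT01, one_mul, one_mul]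
  · rw [ThetaLayerLambdaCongruenceAtTwo.gamma0_mul_apply_one_zero, hT10, hT11, zero_mul, one_mul, zero_add]
  · rw [hadd, hsmall T (by rw [hT00, hT11]; rfl), zero_add]

end FirstColumn

/-! ## §2. (Inv4) ∧ `T₂`-killed ⟹ `χ = 0` -/

section Main

variable {N : ℕ} {χ : Gamma0 N → ZMod 2}

/-- **The four-shift lemma.** Let `N` be odd and `χ : Γ₀(N) → ZMod 2` additive, killing the elements of trace `0, ±1, ±2`, and
`T₂`-KILLED in the explicit form `χ(δ₀) + χ(δ₁) + χ(δ') = 0` for the Hecke correspondents `δⱼ = colB γ j`, `δ' = colD γ` of every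
`γ = (a b; c d)` (first columns `(a + jc, 2c)` or `((a + jc)/2, c)`, and `(2a, c)` or `(a, c/2)`). If `χ` is FOUR-SHIFT INVARIANT —
`χ γ' = χ γ` whenever `γ'` has first column `(a, 4c)` and `γ` has first column `(a, c)` — then `χ = 0`.
Proof (`Φ(a, c)` := the common value of `χ` on first column `(a, c)`, §1): (1) for `4 ∣ c` write `c = 2c₂` and apply the
`T₂`-relation at the element of first column `(a − c₂, c₂)`: its three correspondents have first columns `(a − c₂, 2c₂) =
(a − c₂, 4·(c₂/2))`, `(a, 2c₂) = (a, c)` and `(a − c₂, c₂/2)`, the two outer values agree by four-shift, so `Φ(a, c) = 0`;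
(2) for `a` odd, `Φ(a, c) = Φ(a, 4c) = 0` by four-shift and (1); (3) for `a` even, `Φ(a, c) = Φ(a + c, c) = 0` by `T`.
[cite: CremonaAlgorithms1997, §2.4 (2.4.1)–(2.4.2)] -/
theorem chi_eq_zero_of_fourShift_of_heckeT_two (hN : ¬ 2 ∣ N)
    (hadd : ∀ γ δ : Gamma0 N, χ (γ * δ) = χ γ + χ δ)
    (hsmall : ∀ γ : Gamma0 N, ((γ : SL(2, ℤ)) 0 0 + (γ : SL(2, ℤ)) 1 1).natAbs ≤ 2 → χ γ = 0)
    (hT2 : ∀ γ : Gamma0 N,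
      χ (colB Nat.prime_two γ 0) + χ (colB Nat.prime_two γ 1) + χ (colD Nat.prime_two γ) = 0)
    (h4 : ∀ γ γ' : Gamma0 N, (γ' : SL(2, ℤ)) 0 0 = (γ : SL(2, ℤ)) 0 0 →
      (γ' : SL(2, ℤ)) 1 0 = 4 * (γ : SL(2, ℤ)) 1 0 → χ γ' = χ γ) :
    ∀ γ : Gamma0 N, χ γ = 0 := by
  -- Step 1: `χ` vanishes on every element whose lower-left entry is divisible by `4`.
  have step1 : ∀ γ : Gamma0 N, (4 : ℤ) ∣ (γ : SL(2, ℤ)) 1 0 → χ γ = 0 := by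
    intro γ h4c
    have hcop : IsCoprime ((γ : SL(2, ℤ)) 0 0) ((γ : SL(2, ℤ)) 1 0) :=
      Matrix.SpecialLinearGroup.isCoprime_col (γ : SL(2, ℤ)) 0
    obtain ⟨c₂, hc₂⟩ : (2 : ℤ) ∣ (γ : SL(2, ℤ)) 1 0 := (show (2 : ℤ) ∣ 4 by norm_num).trans h4c
    have hc₂even : (2 : ℤ) ∣ c₂ := by
      obtain ⟨e, he⟩ := h4c
      exact ⟨e, by linarith⟩
    have hNc₂ : (N : ℤ) ∣ c₂ := by
      have h2N : IsCoprime (N : ℤ) 2 := by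
        have h := Nat.isCoprime_iff_coprime.mpr
          (Nat.Coprime.symm ((Nat.Prime.coprime_iff_not_dvd Nat.prime_two).mpr hN))
        exact_mod_cast h
      exact h2N.dvd_of_dvd_mul_left (by rw [← hc₂]; exact dvd_entry_of_mem_Gamma0 N γ.2)
    have haodd : ¬ (2 : ℤ) ∣ (γ : SL(2, ℤ)) 0 0 := fun h2a ↦
      Int.prime_two.not_unit (hcop.isUnit_of_dvd' h2a ((show (2 : ℤ) ∣ 4 by norm_num).trans h4c))
    -- the element `γ₀` of first column `(a − c₂, c₂)`, `c = 2c₂`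
    have hcop₀ : IsCoprime ((γ : SL(2, ℤ)) 0 0 - c₂) c₂ := by
      have h1 : IsCoprime ((γ : SL(2, ℤ)) 0 0) c₂ := by
        rw [hc₂] at hcop
        exact hcop.of_mul_right_right
      simpa [sub_eq_add_neg, mul_comm] using h1.add_mul_right_left (-1)
    obtain ⟨γ₀, hγ₀00, hγ₀10⟩ : ∃ γ₀ : Gamma0 N, (γ₀ : SL(2, ℤ)) 0 0 = (γ : SL(2, ℤ)) 0 0 - c₂ ∧
        (γ₀ : SL(2, ℤ)) 1 0 = c₂ :=
      ⟨Gamma0.mkOfCol _ _ hcop₀ hNc₂, Gamma0.mkOfCol_apply_zero_zero _ _ _ _, Gamma0.mkOfCol_apply_one_zero _ _ _ _⟩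
    have hrel := hT2 γ₀
    -- first columns of the three correspondents: `(a − c₂, 2c₂)`, `(a, 2c₂)`, `(a − c₂, c₂/2)`
    have hodd0 : ¬ (2 : ℤ) ∣ (γ₀ : SL(2, ℤ)) 0 0 + 0 * (γ₀ : SL(2, ℤ)) 1 0 := by
      rw [hγ₀00, zero_mul, add_zero]
      intro h
      exact haodd (by simpa using dvd_add h hc₂even)
    have hodd1 : ¬ (2 : ℤ) ∣ (γ₀ : SL(2, ℤ)) 0 0 + 1 * (γ₀ : SL(2, ℤ)) 1 0 := by
      rw [hγ₀00, hγ₀10, one_mul, sub_add_cancel]; exact haodd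
    have hevenD : (2 : ℤ) ∣ (γ₀ : SL(2, ℤ)) 1 0 := by rw [hγ₀10]; exact hc₂even
    obtain ⟨hB0a, hB0c⟩ := colB_apply_of_not_dvd Nat.prime_two γ₀ 0 hodd0
    obtain ⟨hB1a, hB1c⟩ := colB_apply_of_not_dvd Nat.prime_two γ₀ 1 hodd1
    obtain ⟨hDa, hDc⟩ := colD_apply_of_dvd Nat.prime_two hN γ₀ hevenD
    -- the outer terms agree by four-shift: `2c₂ = 4 (c₂/2)`
    have hout : χ (colB Nat.prime_two γ₀ 0) = χ (colD Nat.prime_two γ₀) := by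
      apply h4
      · rw [hB0a, hDa, zero_mul, add_zero]
      · rw [hB0c, hDc, hγ₀10]
        obtain ⟨e, he⟩ := hc₂even
        rw [he]; push_cast
        rw [Int.mul_ediv_cancel_left _ (by norm_num : (2 : ℤ) ≠ 0)]; ring
    -- so the middle term vanishes; its first column is `(a, c)`
    have hmid : χ (colB Nat.prime_two γ₀ 1) = 0 := by
      have h2 : χ (colB Nat.prime_two γ₀ 0) + χ (colD Nat.prime_two γ₀) = 0 := by
        rw [hout]; exact CharTwo.add_self_eq_zero _
      have h3 : χ (colB Nat.prime_two γ₀ 1) + (χ (colB Nat.prime_two γ₀ 0) + χ (colD Nat.prime_two γ₀)) = 0 := by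
        rw [← hrel]; ring
      rwa [h2, add_zero] at h3
    rw [← hmid]
    apply chi_eq_of_col_eq hadd hsmall
    · rw [hB1a, hγ₀00, hγ₀10]; ring
    · rw [hB1c, hγ₀10, hc₂]; push_cast; ring
  -- Step 2: odd top-left entry ⟹ four-shift to `(a, 4c)` and Step 1.
  have step2 : ∀ γ : Gamma0 N, ¬ (2 : ℤ) ∣ (γ : SL(2, ℤ)) 0 0 → χ γ = 0 := by
    intro γ hodd
    have hcop : IsCoprime ((γ : SL(2, ℤ)) 0 0) (4 * (γ : SL(2, ℤ)) 1 0) := by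
      refine IsCoprime.mul_right ?_ (Matrix.SpecialLinearGroup.isCoprime_col (γ : SL(2, ℤ)) 0)
      rw [show (4 : ℤ) = 2 * 2 by norm_num]
      exact ((Int.prime_two.coprime_iff_not_dvd.mpr hodd).symm).mul_right
        (Int.prime_two.coprime_iff_not_dvd.mpr hodd).symm
    set γ' : Gamma0 N := Gamma0.mkOfCol _ _ hcop ((dvd_entry_of_mem_Gamma0 N γ.2).mul_left 4)
    rw [← h4 γ γ' (Gamma0.mkOfCol_apply_zero_zero _ _ _ _) (Gamma0.mkOfCol_apply_one_zero _ _ _ _)]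
    exact step1 γ' (by rw [Gamma0.mkOfCol_apply_one_zero]; exact dvd_mul_right 4 _)
  -- Step 3: even top-left entry ⟹ translate by `T`.
  intro γ
  by_cases hodd : (2 : ℤ) ∣ (γ : SL(2, ℤ)) 0 0
  · obtain ⟨γ', h00, h10, hχ⟩ := exists_chi_eq_col_add hadd hsmall γ
    rw [← hχ]
    apply step2 γ'
    rw [h00]
    intro h2
    have hc2 : (2 : ℤ) ∣ (γ : SL(2, ℤ)) 1 0 := by simpa using dvd_sub h2 hodd
    exact Int.prime_two.not_unit ((Matrix.SpecialLinearGroup.isCoprime_col (γ : SL(2, ℤ)) 0).isUnit_of_dvd' hodd hc2)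
  · exact step2 γ hodd

/-- The `T₂`-kernel hypothesis of (G″)_N (translate families for ALL cusp forms) yields the explicit relation on the Hecke
correspondents `colB γ 0, colB γ 1, colD γ` (`cuspSymbol_heckeT_eq_sum_col` at `ℓ = 2 ∤ N`).
[cite: CremonaAlgorithms1997, §2.4 (2.4.1)–(2.4.2)] -/
theorem chi_col_rel_of_heckeKernel [NeZero N] (hN : ¬ 2 ∣ N)
    (hker : ∀ (γ : Gamma0 N) (δ : Fin 2 → Gamma0 N) (δ' : Gamma0 N),
      (∀ h : CuspForm (Gamma0 N) 2,
        cuspSymbol (heckeT (Gamma0 N) 2 2 h) γ = ∑ j : Fin 2, cuspSymbol h (δ j) + cuspSymbol h δ') →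
      ∑ j : Fin 2, χ (δ j) + χ δ' = 0) (γ : Gamma0 N) :
    χ (colB Nat.prime_two γ 0) + χ (colB Nat.prime_two γ 1) + χ (colD Nat.prime_two γ) = 0 := by
  have h := hker γ (fun j ↦ colB Nat.prime_two γ ((j : ℕ) : ℤ)) (colD Nat.prime_two γ) fun h ↦ by
    rw [cuspSymbol_heckeT_eq_sum_col Nat.prime_two γ h, if_neg hN]
  simpa [Fin.sum_univ_two, add_assoc] using h

end Main

/-! ## §3. (G′)_N ⟹ (♠)_N ⟹ (G″)_N, and the FLAT / 21437 closers -/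

section Sandwich

variable {N : ℕ}

/-- **(G′)_N ⟹ (♠)_N.** If every additive character through the period homology killing the `4^k`-classes is `ψ ∘ d̄`
(`CuspSpanEvenAtTwo N`), then every such character is four-shift invariant: two elements with first columns `(a, c)` and `(a, 4c)`
have `d ≡ d' ≡ a⁻¹ (mod N)`. [folklore] -/
theorem fourShift_of_cuspSpan [NeZero N] (hG : CuspSpanEvenAtTwo N) :
    ∀ χ : Gamma0 N → ZMod 2,
      (∀ γ δ : Gamma0 N, χ (γ * δ) = χ γ + χ δ) →
      (∀ γ δ : Gamma0 N, periodFunctional N γ = periodFunctional N δ → χ γ = χ δ) →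
      (∀ γ : Gamma0 N, (∃ k : ℕ, 1 ≤ k ∧ ((γ : SL(2, ℤ)) 1 1).natAbs = 4 ^ k) → χ γ = 0) →
      ∀ γ γ' : Gamma0 N, (γ' : SL(2, ℤ)) 0 0 = (γ : SL(2, ℤ)) 0 0 →
        (γ' : SL(2, ℤ)) 1 0 = 4 * (γ : SL(2, ℤ)) 1 0 → χ γ' = χ γ := by
  intro χ hadd hfac hkill γ γ' h00 _h10
  obtain ⟨ψ, _hψ, hχψ⟩ := hG χ hadd hfac hkill
  rw [hχψ γ, hχψ γ']
  congr 1
  -- both lower-right entries are the inverse of `a mod N`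
  have hda := gamma0_apply_one_one_mul_apply_zero_zero γ
  have hda' := gamma0_apply_one_one_mul_apply_zero_zero γ'
  rw [h00] at hda'
  calc (((γ' : SL(2, ℤ)) 1 1 : ℤ) : ZMod N)
      = (((γ' : SL(2, ℤ)) 1 1 : ℤ) : ZMod N) * ((((γ : SL(2, ℤ)) 1 1 : ℤ) : ZMod N) *
          (((γ : SL(2, ℤ)) 0 0 : ℤ) : ZMod N)) := by rw [hda, mul_one]
    _ = ((((γ' : SL(2, ℤ)) 1 1 : ℤ) : ZMod N) * (((γ : SL(2, ℤ)) 0 0 : ℤ) : ZMod N)) *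
          (((γ : SL(2, ℤ)) 1 1 : ℤ) : ZMod N) := by ring
    _ = (((γ : SL(2, ℤ)) 1 1 : ℤ) : ZMod N) := by rw [hda', one_mul]

/-- **(♠)_N ⟹ (G″)_N (odd `N`).** If every additive character through the period homology killing the `4^k`-classes is
four-shift invariant, then every such character which is moreover `T₂`-killed vanishes identically (§2). So the FOUR-SHIFT
node is sufficient for everything (G″)_N is sufficient for. [cite: CremonaAlgorithms1997, §2.4 (2.4.1)–(2.4.2)] -/
theorem heckeKernelSpan_of_fourShift [NeZero N] (hN : ¬ 2 ∣ N)
    (hFS : ∀ χ : Gamma0 N → ZMod 2,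
      (∀ γ δ : Gamma0 N, χ (γ * δ) = χ γ + χ δ) →
      (∀ γ δ : Gamma0 N, periodFunctional N γ = periodFunctional N δ → χ γ = χ δ) →
      (∀ γ : Gamma0 N, (∃ k : ℕ, 1 ≤ k ∧ ((γ : SL(2, ℤ)) 1 1).natAbs = 4 ^ k) → χ γ = 0) →
      ∀ γ γ' : Gamma0 N, (γ' : SL(2, ℤ)) 0 0 = (γ : SL(2, ℤ)) 0 0 →
        (γ' : SL(2, ℤ)) 1 0 = 4 * (γ : SL(2, ℤ)) 1 0 → χ γ' = χ γ) :
    ∀ χ : Gamma0 N → ZMod 2,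
      (∀ γ δ : Gamma0 N, χ (γ * δ) = χ γ + χ δ) →
      (∀ γ δ : Gamma0 N, periodFunctional N γ = periodFunctional N δ → χ γ = χ δ) →
      (∀ (γ : Gamma0 N) (δ : Fin 2 → Gamma0 N) (δ' : Gamma0 N),
        (∀ h : CuspForm (Gamma0 N) 2,
          cuspSymbol (heckeT (Gamma0 N) 2 2 h) γ = ∑ j : Fin 2, cuspSymbol h (δ j) + cuspSymbol h δ') →
        ∑ j : Fin 2, χ (δ j) + χ δ' = 0) →
      (∀ γ : Gamma0 N, (∃ k : ℕ, 1 ≤ k ∧ ((γ : SL(2, ℤ)) 1 1).natAbs = 4 ^ k) → χ γ = 0) →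
      ∀ γ : Gamma0 N, χ γ = 0 := by
  intro χ hadd hfac hker hkill
  have h1 : χ 1 = 0 := by
    have h := hadd 1 1
    rw [mul_one] at h
    -- `χ 1 = χ 1 + χ 1 = 0` in `ZMod 2`
    rw [h]; exact CharTwo.add_self_eq_zero _
  have hsmall : ∀ γ : Gamma0 N, ((γ : SL(2, ℤ)) 0 0 + (γ : SL(2, ℤ)) 1 1).natAbs ≤ 2 → χ γ = 0 := by
    intro γ hγ
    rw [hfac γ 1 (by rw [periodFunctional_eq_zero_of_natAbs_trace_le_two γ hγ, periodFunctional_one]), h1]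
  exact chi_eq_zero_of_fourShift_of_heckeT_two hN hadd hsmall (chi_col_rel_of_heckeKernel hN hker)
    (hFS χ hadd hfac hkill)

variable {W : WeierstrassCurve ℚ} [W.IsElliptic] [W.IsGloballyMinimal]

/-- **(♠)_{N_W} ⟹ FLAT at `(W, f)`** on the habitat⁺ (`W` good supersingular at `2`, `a₂(W) = 0`, `f` its newform): if every
additive character of `Γ₀(N_W)` through the period homology that kills the `4^k`-classes is four-shift invariant, then `2 ∤ L♭`
for every Pollack pair of `f` at `2` (`flatAtTwo_of_heckeKernelSpan` ∘ `heckeKernelSpan_of_fourShift`). Hypothesis weaker-or-equal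
to (G′)_{N_W} (`fourShift_of_cuspSpan`). BSD is not proved by this. [cite: Pollack2003, Conj. 6.3 and Prop. 6.18] -/
theorem flatAtTwo_of_fourShift [NeZero (W.conductorNorm ℤ)] {f : CuspForm (Gamma0 (W.conductorNorm ℤ)) 2}
    (hf : IsNewformOf W f) (hss : GoodSS W 2) (ha : W.frobeniusTrace 2 = 0)
    (hFS : ∀ χ : Gamma0 (W.conductorNorm ℤ) → ZMod 2,
      (∀ γ δ : Gamma0 (W.conductorNorm ℤ), χ (γ * δ) = χ γ + χ δ) →
      (∀ γ δ : Gamma0 (W.conductorNorm ℤ),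
        periodFunctional (W.conductorNorm ℤ) γ = periodFunctional (W.conductorNorm ℤ) δ → χ γ = χ δ) →
      (∀ γ : Gamma0 (W.conductorNorm ℤ), (∃ k : ℕ, 1 ≤ k ∧ ((γ : SL(2, ℤ)) 1 1).natAbs = 4 ^ k) → χ γ = 0) →
      ∀ γ γ' : Gamma0 (W.conductorNorm ℤ), (γ' : SL(2, ℤ)) 0 0 = (γ : SL(2, ℤ)) 0 0 →
        (γ' : SL(2, ℤ)) 1 0 = 4 * (γ : SL(2, ℤ)) 1 0 → χ γ' = χ γ) :
    ∀ Lplus Lminus : IwasawaAlgebra 2, IsPollackPair f 2 Lplus Lminus → ¬ PowerSeries.C (2 : ℤ_[2]) ∣ Lminus :=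
  flatAtTwo_of_heckeKernelSpan hf hss ha
    (heckeKernelSpan_of_fourShift (not_two_dvd_conductorNorm_of_goodSS hss) hFS)

/-- **(♠)_N for every odd `N` ⟹ the registered stub `FlatMuZeroAtTwo` of Kμ⁺** (verbatim). BSD is not proved by this.
[cite: Pollack2003, Conj. 6.3 and Prop. 6.18] -/
theorem flatMuZeroAtTwo_of_fourShift
    (hFS : ∀ (N : ℕ) [NeZero N], ¬ 2 ∣ N → ∀ χ : Gamma0 N → ZMod 2,
      (∀ γ δ : Gamma0 N, χ (γ * δ) = χ γ + χ δ) →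
      (∀ γ δ : Gamma0 N, periodFunctional N γ = periodFunctional N δ → χ γ = χ δ) →
      (∀ γ : Gamma0 N, (∃ k : ℕ, 1 ≤ k ∧ ((γ : SL(2, ℤ)) 1 1).natAbs = 4 ^ k) → χ γ = 0) →
      ∀ γ γ' : Gamma0 N, (γ' : SL(2, ℤ)) 0 0 = (γ : SL(2, ℤ)) 0 0 →
        (γ' : SL(2, ℤ)) 1 0 = 4 * (γ : SL(2, ℤ)) 1 0 → χ γ' = χ γ) :
    ∀ (W : WeierstrassCurve ℚ) [W.IsElliptic] [W.IsGloballyMinimal], ¬ W.HasCM → W.analyticRank = 0 →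
      GoodSS W 2 → W.frobeniusTrace 2 = 0 → W.Δ < 0 →
      ∀ [NeZero (W.conductorNorm ℤ)] (f : CuspForm (Gamma0 (W.conductorNorm ℤ)) 2), IsNewformOf W f →
      ∀ (Lplus Lminus : IwasawaAlgebra 2), IsPollackPair f 2 Lplus Lminus → ¬ PowerSeries.C (2 : ℤ_[2]) ∣ Lminus :=
  fun W _ _ _ _ hss ha _ _ _f hf ↦
    flatAtTwo_of_fourShift hf hss ha (hFS (W.conductorNorm ℤ) (not_two_dvd_conductorNorm_of_goodSS hss))

/-- **(♠)_N for every odd `N` ∧ Abbes–Ullmo Thm. A (by name) ⟹ the route item 21437 `SignedMuAnalyticAtTwoPlus`** (and hence,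
with the four remaining print binders, Kan⁺ `ThetaLayerLambdaCongruenceAtTwo`: feed `flatMuZeroAtTwo_of_fourShift` to
`ThetaLayerLambdaCongruenceAtTwo.thetaLayerLambdaCongruenceAtTwo_of_fourFacts_flatMuZeroAtTwo` of `…NoMazurKenku`). Conditional on
the print fact and on the conjecture-grade per-level node; BSD is not proved by this.
[cite: AbbesUllmo1996, Thm. A] [cite: Pollack2003, Conj. 6.3 and Prop. 6.18] -/
theorem signedMuAnalyticAtTwoPlus_of_abbesUllmo_of_fourShift
    (hAU : abbesUllmo_not_dvd_maninConstant_of_not_dvd_level)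
    (hFS : ∀ (N : ℕ) [NeZero N], ¬ 2 ∣ N → ∀ χ : Gamma0 N → ZMod 2,
      (∀ γ δ : Gamma0 N, χ (γ * δ) = χ γ + χ δ) →
      (∀ γ δ : Gamma0 N, periodFunctional N γ = periodFunctional N δ → χ γ = χ δ) →
      (∀ γ : Gamma0 N, (∃ k : ℕ, 1 ≤ k ∧ ((γ : SL(2, ℤ)) 1 1).natAbs = 4 ^ k) → χ γ = 0) →
      ∀ γ γ' : Gamma0 N, (γ' : SL(2, ℤ)) 0 0 = (γ : SL(2, ℤ)) 0 0 →
        (γ' : SL(2, ℤ)) 1 0 = 4 * (γ : SL(2, ℤ)) 1 0 → χ γ' = χ γ) :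
    SignedMuAnalyticAtTwoPlus :=
  (signedMuAnalyticAtTwoPlus_iff_flatMuZero_of_abbesUllmo hAU).mpr (flatMuZeroAtTwo_of_fourShift hFS)

end Sandwich

end Summit.BirchSwinnertonDyer.BirchSwinnertonDyer.Theorems.SignedMuAtTwo

end
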